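import Literature.Computability.Complexity.SymmetricWeisfeilerLeman
import Literature.Computability.Complexity.SymmetricColourRefinementSymmetry
import HarnessLib

/-!
# Symmetric threshold circuits deciding `k`-WL equivalence with a fixed target, II: size and
# symmetry

Continuation of `SymmetricWeisfeilerLeman.lean` (the DAG `SymWL.wlDAG tgt` on the gate type
`SymWL.Node m k T`).

* `SymWL.card_node_le` — at most `17 · (T+1) · (m^k+1)² · (m+1)²` gates, hence
  `SymWL.compile_wlDAG_size_le`;
* `SymWL.wlDAG_isAut` — for EVERY permutation `ρ` of the x-side vertices, renaming the x-side
  parameters of the gates (`SymWL.Node.act ρ`; rounds and all target-side parameters stay put) is an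
  automorphism of the DAG over the input map `(u,v) ↦ (ρ u, ρ v)`, `u ↦ ρ u` on matrix entries and
  colour bits: gate functions are preserved and argument tuples are carried to the renamed tuples up
  to a permutation of positions (the padded counters over the new vertex `w`, resp. over the tuples
  `ū`, are re-indexed by `ρ`, resp. by post-composition with `ρ` transported to the codes
  `Fin (m^k)`; everything indexed by target-side data is fixed);
* hence the compiled straight-line circuit admits, for every `ρ`, an induced automorphism over that
  input map (`SymWL.compile_wlDAG_isInducedAut`) — the symmetry hypothesis of the materialisation
  theorems of `Summits/PneNP/PneNP/Theorems/SymmetryBudgetWindowBarrierMonadicGuess.lean` — and is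
  square-symmetric in the sense of `GateDAG.IsSymm`.

The permutation bookkeeping (`SymCR.blockPerm`, `SymCR.consPerm`, `SymCR.perm_of_comp_eq`) is the
one of `SymmetricColourRefinementSymmetry.lean`.

## References

* [AndersonDawar2016] M. Anderson, A. Dawar, *On symmetric circuits and fixed-point logics*,
  Theory Comput. Syst. 60 (2017), Def. 6–7, Thm 1, §3.
-/

namespace Literature.Computability.Complexity

open Finset

namespace SymWL

open Node

variable {m k T : ℕ}

/-! ### Size -/

set_option maxHeartbeats 800000 in
/-- **Size of the circuit**: at most `17 · (T+1) · (m^k+1)² · (m+1)²` gates. [folklore] -/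
theorem card_node_le (m k T : ℕ) :
    Fintype.card (Node m k T) ≤ 17 * ((T + 1) * ((m ^ k + 1) * (m ^ k + 1)) * ((m + 1) * (m + 1))) := by
  let V := Fin m
  let P := Fin k → Fin m
  let R := Fin T
  let S := Fin 3 ⊕ (Fin 2 × V × V) ⊕ V ⊕ (P × P) ⊕ (R × P × P × V × V) ⊕ (Fin 4 × R × P × P × V) ⊕
    (R × P × P) ⊕ (Fin 4 × P)
  let ψ : S → Node m k T := fun s =>
    match s with
    | .inl c => if (c : ℕ) = 0 then tt else if (c : ℕ) = 1 then ff else out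
    | .inr (.inl ⟨c, u, v⟩) => if (c : ℕ) = 0 then ex u v else nex u v
    | .inr (.inr (.inl u)) => ncol u
    | .inr (.inr (.inr (.inl ⟨ū, ī⟩))) => mz ū ī
    | .inr (.inr (.inr (.inr (.inl ⟨t, ū, ī, w, w'⟩)))) => ag t ū ī w w'
    | .inr (.inr (.inr (.inr (.inr (.inl ⟨c, t, ū, ī, w'⟩))))) =>
        if (c : ℕ) = 0 then cge t ū ī w' else if (c : ℕ) = 1 then cgt t ū ī w' else
        if (c : ℕ) = 2 then ncgt t ū ī w' else ceq t ū ī w'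
    | .inr (.inr (.inr (.inr (.inr (.inr (.inl ⟨t, ū, ī⟩)))))) => ms t ū ī
    | .inr (.inr (.inr (.inr (.inr (.inr (.inr ⟨c, ī⟩)))))) =>
        if (c : ℕ) = 0 then oge ī else if (c : ℕ) = 1 then ogt ī else
        if (c : ℕ) = 2 then nogt ī else oeq ī
  have hψ : Function.Surjective ψ := by
    intro l
    cases l with
    | tt => exact ⟨.inl 0, rfl⟩
    | ff => exact ⟨.inl 1, rfl⟩
    | out => exact ⟨.inl 2, rfl⟩
    | ex u v => exact ⟨.inr (.inl ⟨0, u, v⟩), rfl⟩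
    | nex u v => exact ⟨.inr (.inl ⟨1, u, v⟩), rfl⟩
    | ncol u => exact ⟨.inr (.inr (.inl u)), rfl⟩
    | mz ū ī => exact ⟨.inr (.inr (.inr (.inl ⟨ū, ī⟩))), rfl⟩
    | ag t ū ī w w' => exact ⟨.inr (.inr (.inr (.inr (.inl ⟨t, ū, ī, w, w'⟩)))), rfl⟩
    | cge t ū ī w' => exact ⟨.inr (.inr (.inr (.inr (.inr (.inl ⟨0, t, ū, ī, w'⟩))))), rfl⟩
    | cgt t ū ī w' => exact ⟨.inr (.inr (.inr (.inr (.inr (.inl ⟨1, t, ū, ī, w'⟩))))), rfl⟩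
    | ncgt t ū ī w' => exact ⟨.inr (.inr (.inr (.inr (.inr (.inl ⟨2, t, ū, ī, w'⟩))))), rfl⟩
    | ceq t ū ī w' => exact ⟨.inr (.inr (.inr (.inr (.inr (.inl ⟨3, t, ū, ī, w'⟩))))), rfl⟩
    | ms t ū ī => exact ⟨.inr (.inr (.inr (.inr (.inr (.inr (.inl ⟨t, ū, ī⟩)))))), rfl⟩
    | oge ī => exact ⟨.inr (.inr (.inr (.inr (.inr (.inr (.inr ⟨0, ī⟩)))))), rfl⟩
    | ogt ī => exact ⟨.inr (.inr (.inr (.inr (.inr (.inr (.inr ⟨1, ī⟩)))))), rfl⟩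
    | nogt ī => exact ⟨.inr (.inr (.inr (.inr (.inr (.inr (.inr ⟨2, ī⟩)))))), rfl⟩
    | oeq ī => exact ⟨.inr (.inr (.inr (.inr (.inr (.inr (.inr ⟨3, ī⟩)))))), rfl⟩
  have hcard := Fintype.card_le_of_surjective ψ hψ
  set p := m ^ k with hp
  have hP : Fintype.card P = p := by simp [P, hp]
  set B := (T + 1) * ((p + 1) * (p + 1)) * ((m + 1) * (m + 1)) with hB
  have hB' : B = (T + 1) * (p + 1) * (p + 1) * (m + 1) * (m + 1) := by rw [hB]; ring
  have b0 : 0 < B := by rw [hB']; positivity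
  have b1 : m * m ≤ B := by
    rw [hB']
    calc m * m = 1 * 1 * 1 * m * m := by ring
      _ ≤ (T + 1) * (p + 1) * (p + 1) * (m + 1) * (m + 1) := by gcongr <;> omega
  have b2 : m ≤ B := le_trans (Nat.le_mul_self m) b1
  have b3 : p * p ≤ B := by
    rw [hB']
    calc p * p = 1 * p * p * 1 * 1 := by ring
      _ ≤ (T + 1) * (p + 1) * (p + 1) * (m + 1) * (m + 1) := by gcongr <;> omega
  have b4 : T * (p * (p * (m * m))) ≤ B := by
    rw [hB']
    calc T * (p * (p * (m * m))) = T * p * p * m * m := by ring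
      _ ≤ (T + 1) * (p + 1) * (p + 1) * (m + 1) * (m + 1) := by gcongr <;> omega
  have b5 : T * (p * (p * m)) ≤ B := by
    rw [hB']
    calc T * (p * (p * m)) = T * p * p * m * 1 := by ring
      _ ≤ (T + 1) * (p + 1) * (p + 1) * (m + 1) * (m + 1) := by gcongr <;> omega
  have b6 : T * (p * p) ≤ B := by
    rw [hB']
    calc T * (p * p) = T * p * p * 1 * 1 := by ring
      _ ≤ (T + 1) * (p + 1) * (p + 1) * (m + 1) * (m + 1) := by gcongr <;> omega
  have b7 : p ≤ B := le_trans (Nat.le_mul_self p) b3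
  have hS : Fintype.card S = 3 + (2 * (m * m) + (m + (p * p + (T * (p * (p * (m * m))) +
      (4 * (T * (p * (p * m))) + (T * (p * p) + 4 * p)))))) := by
    simp only [S, V, R, Fintype.card_sum, Fintype.card_prod, Fintype.card_fin, hP]
  rw [hS] at hcard
  omega

/-- The compiled circuit has at most `17 · (T+1) · (m^k+1)² · (m+1)²` gates. [folklore] -/
theorem compile_wlDAG_size_le (tgt : Target m k T) :
    (wlDAG tgt).compile.size ≤ 17 * ((T + 1) * ((m ^ k + 1) * (m ^ k + 1)) * ((m + 1) * (m + 1))) := by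
  rw [Circuit.size, GateDAG.compile_gates_length]
  exact card_node_le m k T

/-! ### Symmetry: every permutation of the x-side vertices is an automorphism -/

section Symmetry

variable (tgt : Target m k T) (ρ : Equiv.Perm (Fin m))

/-! The relabelling of wires induced by `ρ` is `Sum.map (Sum.map (SymCR.diag ρ) ρ) (actEquiv ρ)`:
the input map — diagonal on matrix entries, `ρ` on colour bits — on input wires, `act ρ` on gates. -/

/-- Relabelling a relation literal renames its two vertices. [folklore] -/
theorem map_relW (a b : Fin m) (r : Fin 3) : (Sum.map (Sum.map (SymCR.diag ρ) ρ) (actEquiv ρ) : W m k T → W m k T) (relW a b r : W m k T) = relW (ρ a) (ρ b) r := by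
  simp only [relW, ρ.injective.eq_iff]
  split_ifs <;> rfl

/-- Relabelling a colour literal renames its vertex. [folklore] -/
theorem map_colW (a : Fin m) (b : Bool) : (Sum.map (Sum.map (SymCR.diag ρ) ρ) (actEquiv ρ) : W m k T → W m k T) (colW a b : W m k T) = colW (ρ a) b := by
  simp only [colW]
  split_ifs <;> rfl

/-- Relabelling a match wire renames the x-side tuple. [folklore] -/
theorem map_Mw (t : Fin (T + 1)) (ū ī : Fin k → Fin m) :
    (Sum.map (Sum.map (SymCR.diag ρ) ρ) (actEquiv ρ) : W m k T → W m k T) (Mw t ū ī) = Mw t (fun j => ρ (ū j)) ī := by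
  rcases t with ⟨_ | t, ht⟩ <;> rfl

/-- Relabelling a match wire of substituted tuples. [folklore] -/
theorem map_Mw_update (t : Fin (T + 1)) (ū ī : Fin k → Fin m) (j : Fin k) (w w' : Fin m) :
    (Sum.map (Sum.map (SymCR.diag ρ) ρ) (actEquiv ρ) : W m k T → W m k T) (Mw t (Function.update ū j w) (Function.update ī j w')) =
      Mw t (Function.update (fun i => ρ (ū i)) j (ρ w)) (Function.update ī j w') := by
  rw [map_Mw]
  congr 1
  exact Function.comp_update (f := ρ) ū j w

/-- Relabelling fixes the padding wires. [folklore] -/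
theorem map_pad (n θ : ℕ) (j : Fin (n + 1)) : (Sum.map (Sum.map (SymCR.diag ρ) ρ) (actEquiv ρ) : W m k T → W m k T) (pad n θ j : W m k T) = pad n θ j := by
  simp only [pad]
  split_ifs <;> rfl

/-- Post-composition with `ρ`, transported to the codes `Fin (m ^ k)` of `k`-tuples, decoded:
`decode (π c) = ρ ∘ decode c` for `π = decode⁻¹ ∘ (ρ ∘ ·) ∘ decode`. Definitionally an instance of
Mathlib's `Equiv.symm_apply_apply`; kept under its own name as the `simp only` rewriting rule used
below (dedup-02693). [folklore] -/
theorem symm_codePerm (c : Fin (m ^ k)) :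
    finFunctionFinEquiv.symm ((finFunctionFinEquiv.symm.trans
      (((Equiv.refl (Fin k)).arrowCongr ρ).trans finFunctionFinEquiv) : Equiv.Perm (Fin (m ^ k))) c) =
      fun j => ρ (finFunctionFinEquiv.symm c j) :=
  Equiv.symm_apply_apply finFunctionFinEquiv _

/-- The argument tuple of a padded counter, re-indexed: permuting the counted block by `π` (and
fixing the leading constant and the padding) is re-indexing by `blockPerm (consPerm π) 1`. [folklore] -/
theorem append_cons_pad_perm {n θ : ℕ} (f : Fin n → W m k T) (π : Equiv.Perm (Fin n))
    (a : Fin ((n + 1) + (n + 1))) :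
    Fin.append (Fin.cons (Sum.inr ff) f) (pad n θ) (SymCR.blockPerm (SymCR.consPerm π) 1 a) =
      Fin.append (Fin.cons (Sum.inr ff) (f ∘ π)) (pad n θ) a := by
  rw [SymCR.append_blockPerm]
  induction a using Fin.addCases with
  | left i =>
    simp only [Fin.append_left, Function.comp_apply]
    rw [SymCR.cons_consPerm]
  | right j => simp only [Fin.append_right, Function.comp_apply, Equiv.Perm.coe_one, id_eq]

/-- **Renaming the x-side vertices is an automorphism**: `act ρ`, over the input map
`Sum.map (diag ρ) ρ`, is an
automorphism of the DAG, for EVERY permutation `ρ`. [cite: AndersonDawar2016, Def. 6–7] -/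
theorem wlDAG_isAut : (wlDAG tgt).IsAut (Sum.map (SymCR.diag ρ) ρ) (actEquiv ρ) := by
  refine ⟨rfl, fun l => by cases l <;> rfl, fun l => ?_⟩
  show (List.ofFn (Node.args tgt (act ρ l))).Perm ((List.ofFn (Node.args tgt l)).map (Sum.map (Sum.map (SymCR.diag ρ) ρ) (actEquiv ρ) : W m k T → W m k T))
  cases l with
  | tt => exact SymCR.perm_of_eq (n := 0) fun a => a.elim0
  | ff => exact SymCR.perm_of_eq (n := 0) fun a => a.elim0
  | ex u v => exact SymCR.perm_of_eq (n := 2) fun a => by simp only [act, args]; split_ifs <;> rfl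
  | nex u v => exact SymCR.perm_of_eq (n := 1) fun a => rfl
  | ncol u => exact SymCR.perm_of_eq (n := 1) fun a => rfl
  | mz ū ī =>
    refine SymCR.perm_of_eq (n := k * k + k) fun a => ?_
    simp only [act, args]
    induction a using Fin.addCases with
    | left p => simp only [Fin.append_left, map_relW]
    | right j => simp only [Fin.append_right, map_colW]
  | ag t ū ī w w' =>
    refine SymCR.perm_of_eq (n := k + 1 + k) fun a => ?_
    simp only [act, args]
    induction a using Fin.addCases with
    | left p =>
      simp only [Fin.append_left]
      induction p using Fin.addCases with
      | left j => simp only [Fin.append_left, map_relW]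
      | right j => simp only [Fin.append_right, map_colW]
    | right j => simp only [Fin.append_right, map_Mw_update]
  | cge t ū ī w' =>
    refine SymCR.perm_of_comp_eq (n := (m + 1) + (m + 1)) (SymCR.blockPerm (SymCR.consPerm ρ) 1)
      fun a => ?_
    simp only [act, args]
    rw [append_cons_pad_perm]
    induction a using Fin.addCases with
    | left i =>
      simp only [Fin.append_left]
      refine Fin.cases ?_ (fun w => ?_) i <;> rfl
    | right j => simp only [Fin.append_right, map_pad]
  | cgt t ū ī w' =>
    refine SymCR.perm_of_comp_eq (n := (m + 1) + (m + 1)) (SymCR.blockPerm (SymCR.consPerm ρ) 1)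
      fun a => ?_
    simp only [act, args]
    rw [append_cons_pad_perm]
    induction a using Fin.addCases with
    | left i =>
      simp only [Fin.append_left]
      refine Fin.cases ?_ (fun w => ?_) i <;> rfl
    | right j => simp only [Fin.append_right, map_pad]
  | ncgt t ū ī w' => exact SymCR.perm_of_eq (n := 1) fun a => rfl
  | ceq t ū ī w' => exact SymCR.perm_of_eq (n := 2) fun a => by simp only [act, args]; split_ifs <;> rfl
  | ms t ū ī =>
    refine SymCR.perm_of_eq (n := m + 1) fun a => ?_
    simp only [act, args]
    refine Fin.cases ?_ (fun w' => ?_) a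
    · simp only [Fin.cons_zero, map_Mw]
    · simp only [Fin.cons_succ]; rfl
  | oge ī =>
    refine SymCR.perm_of_comp_eq (n := (m ^ k + 1) + (m ^ k + 1))
      (SymCR.blockPerm (SymCR.consPerm (finFunctionFinEquiv.symm.trans
        (((Equiv.refl (Fin k)).arrowCongr ρ).trans finFunctionFinEquiv))) 1) fun a => ?_
    simp only [act, args]
    rw [append_cons_pad_perm]
    induction a using Fin.addCases with
    | left i =>
      simp only [Fin.append_left]
      refine Fin.cases ?_ (fun c => ?_) i
      · rfl
      · simp only [Fin.cons_succ, Function.comp_apply, map_Mw, symm_codePerm]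
    | right j => simp only [Fin.append_right, map_pad]
  | ogt ī =>
    refine SymCR.perm_of_comp_eq (n := (m ^ k + 1) + (m ^ k + 1))
      (SymCR.blockPerm (SymCR.consPerm (finFunctionFinEquiv.symm.trans
        (((Equiv.refl (Fin k)).arrowCongr ρ).trans finFunctionFinEquiv))) 1) fun a => ?_
    simp only [act, args]
    rw [append_cons_pad_perm]
    induction a using Fin.addCases with
    | left i =>
      simp only [Fin.append_left]
      refine Fin.cases ?_ (fun c => ?_) i
      · rfl
      · simp only [Fin.cons_succ, Function.comp_apply, map_Mw, symm_codePerm]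
    | right j => simp only [Fin.append_right, map_pad]
  | nogt ī => exact SymCR.perm_of_eq (n := 1) fun a => rfl
  | oeq ī => exact SymCR.perm_of_eq (n := 2) fun a => by simp only [act, args]; split_ifs <;> rfl
  | out => exact SymCR.perm_of_eq (n := m ^ k) fun a => rfl

/-- **The compiled straight-line circuit admits an induced automorphism over the renaming of the
inputs, for every permutation of the vertices** (the symmetry hypothesis of the materialisation of
monadic guesses). [cite: AndersonDawar2016, Thm 1 (FPC to symmetric circuits)] -/
theorem compile_wlDAG_isInducedAut (σ : Equiv.Perm (Fin m)) :
    ∃ τ : Equiv.Perm (Fin (wlDAG tgt).compile.gates.length),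
      (wlDAG tgt).compile.IsInducedAut (Sum.map (fun p : Fin m × Fin m => (σ p.1, σ p.2)) σ) τ :=
  ⟨_, (wlDAG_isAut tgt σ).isInducedAut_compile⟩

/-- The DAG is symmetric under the renamings of the inputs by any set of vertex permutations.
[cite: AndersonDawar2016, Def. 7] -/
theorem wlDAG_isSymm (P : Set ((Fin m × Fin m) ⊕ Fin m → (Fin m × Fin m) ⊕ Fin m))
    (hP : ∀ π ∈ P, ∃ ρ : Equiv.Perm (Fin m), π = Sum.map (SymCR.diag ρ) ρ) : (wlDAG tgt).IsSymm P := by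
  intro π hπ
  obtain ⟨ρ', rfl⟩ := hP π hπ
  exact ⟨actEquiv ρ', wlDAG_isAut tgt ρ'⟩

end Symmetry

end SymWL

end Literature.Computability.Complexity
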